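import Mathlib

/-!
# Sharp pair positivity for bilinear-unit complex tangents (`TangentSkeletonNearStraightL`, stmt-NavierStokesRegularity-23320,
# registered stub `stub_stripPropagation` — principal-branch control for the contour shift)

For `a, b : Fin 3 → ℂ` with the BILINEAR unit relations `∑ aᵢ² = ∑ bᵢ² = 1` (the analytic continuation of unit speed, see
`Theorems.StadiumBilinearUnitSpeed`) and real unit vectors `t, t'`:

* `re_dot_ge` : `Re ∑ aᵢbᵢ ≥ 1 − (r + eₐ + e_b)²/2`, where `r = ‖t − t'‖`, `eₐ = ‖Re a − t‖`, `e_b = ‖Re b − t'‖` (Euclidean) — the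
  IMAGINARY deviations `Im a`, `Im b` do NOT enter: writing `a = p + iq` the unit relation gives `p ⊥ q`, `|p|² = 1 + |q|²`, and the
  cross term `(|q|² + |q'|²)/2 − q·q' ≥ 0` absorbs them exactly;
* `abs_im_dot_le` : `|Im ∑ aᵢbᵢ| ≤ (‖Im a‖ + ‖Im b‖)·(r + eₐ + e_b)`.

Compared with the landed chord estimate `Theorems.StadiumChord.chord_sq_sub_sq_norm_le` (`‖Q − s²‖ ≤ 6η²s²`, `η` the sup-norm deviation
INCLUDING the imaginary part) this is what makes the end descents of the contour shift work with Cauchy estimates only: on the stadium the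
first-order deviation of `F′(s+it)` from `X′(s)` is imaginary (`it·X″`), the real deviation is second order.  Pure finite-dimensional algebra
(Cauchy–Schwarz on `Fin 3`).  HONEST FRAMING: a tool for a HYPOTHETICAL filament skeleton on the NEGATIVE side of a MODEL route; nothing here
bears on Navier–Stokes regularity or blow-up.  `--supports stmt-NavierStokesRegularity-23320`.
-/

set_option linter.dupNamespace false

namespace Summit.NavierStokesRegularity.NavierStokesRegularity.Theorems.StadiumPairPositivity

open Finset Real

/-- Discrete Cauchy–Schwarz on `Fin 3`: `∑ fᵢgᵢ ≤ √(∑ fᵢ²)·√(∑ gᵢ²)`. [folklore] -/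
theorem sum_mul_le_sqrt_mul_sqrt (f g : Fin 3 → ℝ) :
    ∑ i, f i * g i ≤ √(∑ i, f i ^ 2) * √(∑ i, g i ^ 2) := by
  have h := Finset.sum_mul_sq_le_sq_mul_sq Finset.univ f g
  have hf : 0 ≤ ∑ i, f i ^ 2 := Finset.sum_nonneg fun i _ => sq_nonneg _
  rw [← Real.sqrt_mul hf]
  calc ∑ i, f i * g i ≤ |∑ i, f i * g i| := le_abs_self _
    _ = √((∑ i, f i * g i) ^ 2) := (Real.sqrt_sq_eq_abs _).symm
    _ ≤ √((∑ i, f i ^ 2) * ∑ i, g i ^ 2) := Real.sqrt_le_sqrt h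

/-- Two-sided discrete Cauchy–Schwarz on `Fin 3`: `|∑ fᵢgᵢ| ≤ √(∑ fᵢ²)·√(∑ gᵢ²)`. [folklore] -/
theorem abs_sum_mul_le_sqrt_mul_sqrt (f g : Fin 3 → ℝ) :
    |∑ i, f i * g i| ≤ √(∑ i, f i ^ 2) * √(∑ i, g i ^ 2) := by
  refine abs_le.2 ⟨?_, sum_mul_le_sqrt_mul_sqrt f g⟩
  have h := sum_mul_le_sqrt_mul_sqrt (fun i => -f i) g
  have h1 : ∑ i, (fun i => -f i) i * g i = -∑ i, f i * g i := by
    simp [Finset.sum_neg_distrib, neg_mul]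
  have h2 : ∑ i, (fun i => -f i) i ^ 2 = ∑ i, f i ^ 2 := by simp
  rw [h1, h2] at h
  linarith

/-- Real part of the bilinear unit relation: `∑ (Re aᵢ)² − ∑ (Im aᵢ)² = 1`. [folklore] -/
theorem sum_re_sq_sub_im_sq (a : Fin 3 → ℂ) (ha : ∑ i, a i ^ 2 = 1) :
    ∑ i, (a i).re ^ 2 - ∑ i, (a i).im ^ 2 = 1 := by
  have h := congrArg Complex.re ha
  simp only [Complex.re_sum, sq, Complex.mul_re, Complex.one_re] at h
  rw [← Finset.sum_sub_distrib]
  simpa [sq] using h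

/-- Imaginary part of the bilinear unit relation: `∑ Re aᵢ · Im aᵢ = 0` (`Re a ⊥ Im a`). [folklore] -/
theorem sum_re_mul_im (a : Fin 3 → ℂ) (ha : ∑ i, a i ^ 2 = 1) :
    ∑ i, (a i).re * (a i).im = 0 := by
  have h := congrArg Complex.im ha
  simp only [Complex.im_sum, sq, Complex.mul_im, Complex.one_im] at h
  have h2 : ∑ i, ((a i).re * (a i).im + (a i).im * (a i).re) = 2 * ∑ i, (a i).re * (a i).im := by
    rw [Finset.mul_sum]; refine Finset.sum_congr rfl fun i _ => by ring
  linarith [h2.symm.trans h]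

/-- **Sharp pair positivity.**  For bilinear-unit `a, b : Fin 3 → ℂ` and real unit vectors `t, t'`:
`Re ∑ aᵢbᵢ ≥ 1 − (‖t − t'‖ + ‖Re a − t‖ + ‖Re b − t'‖)²/2` — no hypothesis on `Im a`, `Im b`. [folklore] -/
theorem re_dot_ge (a b : Fin 3 → ℂ) (t t' : Fin 3 → ℝ)
    (ha : ∑ i, a i ^ 2 = 1) (hb : ∑ i, b i ^ 2 = 1) (ht : ∑ i, t i ^ 2 = 1) (ht' : ∑ i, t' i ^ 2 = 1) :
    1 - (√(∑ i, (t i - t' i) ^ 2) + √(∑ i, ((a i).re - t i) ^ 2) + √(∑ i, ((b i).re - t' i) ^ 2)) ^ 2 / 2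
      ≤ (∑ i, a i * b i).re := by
  -- real coordinates
  set e : Fin 3 → ℝ := fun i => (a i).re - t i with he
  set e' : Fin 3 → ℝ := fun i => (b i).re - t' i with he'
  set d : Fin 3 → ℝ := fun i => t i - t' i with hd
  set q : Fin 3 → ℝ := fun i => (a i).im with hq
  set q' : Fin 3 → ℝ := fun i => (b i).im with hq'
  -- the norms
  set R : ℝ := √(∑ i, d i ^ 2) with hR
  set E : ℝ := √(∑ i, e i ^ 2) with hE
  set E' : ℝ := √(∑ i, e' i ^ 2) with hE'
  set Qa : ℝ := √(∑ i, q i ^ 2) with hQa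
  set Qb : ℝ := √(∑ i, q' i ^ 2) with hQb
  have hd2 : 0 ≤ ∑ i, d i ^ 2 := Finset.sum_nonneg fun i _ => sq_nonneg _
  have he2 : 0 ≤ ∑ i, e i ^ 2 := Finset.sum_nonneg fun i _ => sq_nonneg _
  have he'2 : 0 ≤ ∑ i, e' i ^ 2 := Finset.sum_nonneg fun i _ => sq_nonneg _
  have hq2 : 0 ≤ ∑ i, q i ^ 2 := Finset.sum_nonneg fun i _ => sq_nonneg _
  have hq'2 : 0 ≤ ∑ i, q' i ^ 2 := Finset.sum_nonneg fun i _ => sq_nonneg _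
  have hRsq : R ^ 2 = ∑ i, d i ^ 2 := Real.sq_sqrt hd2
  have hEsq : E ^ 2 = ∑ i, e i ^ 2 := Real.sq_sqrt he2
  have hE'sq : E' ^ 2 = ∑ i, e' i ^ 2 := Real.sq_sqrt he'2
  have hQasq : Qa ^ 2 = ∑ i, q i ^ 2 := Real.sq_sqrt hq2
  have hQbsq : Qb ^ 2 = ∑ i, q' i ^ 2 := Real.sq_sqrt hq'2
  have hR0 : 0 ≤ R := Real.sqrt_nonneg _
  have hE0 : 0 ≤ E := Real.sqrt_nonneg _
  have hE'0 : 0 ≤ E' := Real.sqrt_nonneg _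
  have hQa0 : 0 ≤ Qa := Real.sqrt_nonneg _
  have hQb0 : 0 ≤ Qb := Real.sqrt_nonneg _
  -- the unit relations in real form
  have ha_re := sum_re_sq_sub_im_sq a ha
  have hb_re := sum_re_sq_sub_im_sq b hb
  have ha_im := sum_re_mul_im a ha
  have hb_im := sum_re_mul_im b hb
  -- the target in real form
  have hre : (∑ i, a i * b i).re = ∑ i, ((a i).re * (b i).re - q i * q' i) := by
    simp only [Complex.re_sum, Complex.mul_re, hq, hq']
  -- (1) ∑ t t' = 1 − R²/2
  have h1 : ∑ i, t i * t' i = 1 - (∑ i, d i ^ 2) / 2 := by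
    have : ∑ i, d i ^ 2 = ∑ i, t i ^ 2 - 2 * ∑ i, t i * t' i + ∑ i, t' i ^ 2 := by
      simp only [hd, Finset.mul_sum, ← Finset.sum_sub_distrib, ← Finset.sum_add_distrib]
      refine Finset.sum_congr rfl fun i _ => by ring
    rw [this, ht, ht']; ring
  -- (2) ∑ t e = (∑ q² − ∑ e²)/2, and the same for b
  have h2a : ∑ i, t i * e i = ((∑ i, q i ^ 2) - ∑ i, e i ^ 2) / 2 := by
    have hexp : ∑ i, (a i).re ^ 2 = ∑ i, t i ^ 2 + 2 * ∑ i, t i * e i + ∑ i, e i ^ 2 := by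
      simp only [he, Finset.mul_sum, ← Finset.sum_add_distrib]
      refine Finset.sum_congr rfl fun i _ => by ring
    have hq_eq : ∑ i, q i ^ 2 = ∑ i, (a i).im ^ 2 := by simp only [hq]
    rw [hq_eq]; rw [ht] at hexp; linarith
  have h2b : ∑ i, t' i * e' i = ((∑ i, q' i ^ 2) - ∑ i, e' i ^ 2) / 2 := by
    have hexp : ∑ i, (b i).re ^ 2 = ∑ i, t' i ^ 2 + 2 * ∑ i, t' i * e' i + ∑ i, e' i ^ 2 := by
      simp only [he', Finset.mul_sum, ← Finset.sum_add_distrib]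
      refine Finset.sum_congr rfl fun i _ => by ring
    have hq_eq : ∑ i, q' i ^ 2 = ∑ i, (b i).im ^ 2 := by simp only [hq']
    rw [hq_eq]; rw [ht'] at hexp; linarith
  -- (3) the expansion of ∑ Re a · Re b
  have h3 : ∑ i, (a i).re * (b i).re =
      ∑ i, t i * t' i + (∑ i, t' i * e' i + ∑ i, d i * e' i) + (∑ i, t i * e i - ∑ i, d i * e i) + ∑ i, e i * e' i := by
    simp only [he, he', hd, ← Finset.sum_add_distrib, ← Finset.sum_sub_distrib]
    refine Finset.sum_congr rfl fun i _ => by ring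
  -- (4) Cauchy–Schwarz bounds
  have c1 : |∑ i, d i * e' i| ≤ R * E' := abs_sum_mul_le_sqrt_mul_sqrt d e'
  have c2 : |∑ i, d i * e i| ≤ R * E := abs_sum_mul_le_sqrt_mul_sqrt d e
  have c3 : |∑ i, e i * e' i| ≤ E * E' := abs_sum_mul_le_sqrt_mul_sqrt e e'
  have c4 : ∑ i, q i * q' i ≤ Qa * Qb := sum_mul_le_sqrt_mul_sqrt q q'
  have c1' := (abs_le.1 c1).1
  have c2' := (abs_le.1 c2).2
  have c3' := (abs_le.1 c3).1
  -- (5) assemble: Re ∑ a b ≥ 1 − (R + E + E')²/2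
  have hmain : 1 - (R + E + E') ^ 2 / 2 ≤ (∑ i, a i * b i).re := by
    rw [hre, Finset.sum_sub_distrib, h3, h1, h2a, h2b]
    nlinarith [sq_nonneg (Qa - Qb), hRsq, hEsq, hE'sq, hQasq, hQbsq]
  exact hmain

/-- **Imaginary part of the pair product.**  For bilinear-unit `a, b : Fin 3 → ℂ` and real unit vectors `t, t'`:
`|Im ∑ aᵢbᵢ| ≤ (‖Im a‖ + ‖Im b‖)·(‖t − t'‖ + ‖Re a − t‖ + ‖Re b − t'‖)`. [folklore] -/
theorem abs_im_dot_le (a b : Fin 3 → ℂ) (t t' : Fin 3 → ℝ)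
    (ha : ∑ i, a i ^ 2 = 1) (hb : ∑ i, b i ^ 2 = 1) :
    |(∑ i, a i * b i).im| ≤
      (√(∑ i, (a i).im ^ 2) + √(∑ i, (b i).im ^ 2)) *
        (√(∑ i, (t i - t' i) ^ 2) + √(∑ i, ((a i).re - t i) ^ 2) + √(∑ i, ((b i).re - t' i) ^ 2)) := by
  set e : Fin 3 → ℝ := fun i => (a i).re - t i with he
  set e' : Fin 3 → ℝ := fun i => (b i).re - t' i with he'
  set d : Fin 3 → ℝ := fun i => t i - t' i with hd
  set q : Fin 3 → ℝ := fun i => (a i).im with hq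
  set q' : Fin 3 → ℝ := fun i => (b i).im with hq'
  set R : ℝ := √(∑ i, d i ^ 2) with hR
  set E : ℝ := √(∑ i, e i ^ 2) with hE
  set E' : ℝ := √(∑ i, e' i ^ 2) with hE'
  set Qa : ℝ := √(∑ i, q i ^ 2) with hQa
  set Qb : ℝ := √(∑ i, q' i ^ 2) with hQb
  have hR0 : 0 ≤ R := Real.sqrt_nonneg _
  have hE0 : 0 ≤ E := Real.sqrt_nonneg _
  have hE'0 : 0 ≤ E' := Real.sqrt_nonneg _
  have hQa0 : 0 ≤ Qa := Real.sqrt_nonneg _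
  have hQb0 : 0 ≤ Qb := Real.sqrt_nonneg _
  have ha_im := sum_re_mul_im a ha
  have hb_im := sum_re_mul_im b hb
  -- Im ∑ a b = ∑ (Re a · Im b + Im a · Re b)
  have him : (∑ i, a i * b i).im = ∑ i, (a i).re * q' i + ∑ i, q i * (b i).re := by
    simp only [Complex.im_sum, Complex.mul_im, hq, hq', ← Finset.sum_add_distrib]
  -- ∑ Re a · q' = −∑ e' q' + ∑ d q' + ∑ e q'   (uses ∑ Re b · Im b = 0)
  have hx : ∑ i, (a i).re * q' i = -(∑ i, e' i * q' i) + ∑ i, d i * q' i + ∑ i, e i * q' i := by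
    have hb0 : ∑ i, (b i).re * q' i = 0 := by simpa only [hq'] using hb_im
    have : ∑ i, (a i).re * q' i = ∑ i, (b i).re * q' i - ∑ i, e' i * q' i + ∑ i, d i * q' i + ∑ i, e i * q' i := by
      simp only [he, he', hd, ← Finset.sum_add_distrib, ← Finset.sum_sub_distrib]
      refine Finset.sum_congr rfl fun i _ => by ring
    rw [this, hb0]; ring
  have hy : ∑ i, q i * (b i).re = -(∑ i, q i * e i) - ∑ i, q i * d i + ∑ i, q i * e' i := by
    have ha0 : ∑ i, q i * (a i).re = 0 := by
      rw [← ha_im]; refine Finset.sum_congr rfl fun i _ => by simp only [hq]; ring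
    have : ∑ i, q i * (b i).re = ∑ i, q i * (a i).re - ∑ i, q i * e i - ∑ i, q i * d i + ∑ i, q i * e' i := by
      simp only [he, he', hd, ← Finset.sum_add_distrib, ← Finset.sum_sub_distrib]
      refine Finset.sum_congr rfl fun i _ => by ring
    rw [this, ha0]; ring
  have c1 : |∑ i, e' i * q' i| ≤ E' * Qb := abs_sum_mul_le_sqrt_mul_sqrt e' q'
  have c2 : |∑ i, d i * q' i| ≤ R * Qb := abs_sum_mul_le_sqrt_mul_sqrt d q'
  have c3 : |∑ i, e i * q' i| ≤ E * Qb := abs_sum_mul_le_sqrt_mul_sqrt e q'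
  have c4 : |∑ i, q i * e i| ≤ Qa * E := abs_sum_mul_le_sqrt_mul_sqrt q e
  have c5 : |∑ i, q i * d i| ≤ Qa * R := abs_sum_mul_le_sqrt_mul_sqrt q d
  have c6 : |∑ i, q i * e' i| ≤ Qa * E' := abs_sum_mul_le_sqrt_mul_sqrt q e'
  rw [him, hx, hy]
  have htri : |-(∑ i, e' i * q' i) + ∑ i, d i * q' i + ∑ i, e i * q' i +
      (-(∑ i, q i * e i) - ∑ i, q i * d i + ∑ i, q i * e' i)| ≤
      (E' * Qb + R * Qb + E * Qb) + (Qa * E + Qa * R + Qa * E') := by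
    have t1 := abs_add_le (-(∑ i, e' i * q' i) + ∑ i, d i * q' i + ∑ i, e i * q' i)
      (-(∑ i, q i * e i) - ∑ i, q i * d i + ∑ i, q i * e' i)
    have t2 : |-(∑ i, e' i * q' i) + ∑ i, d i * q' i + ∑ i, e i * q' i| ≤ E' * Qb + R * Qb + E * Qb := by
      refine (abs_add_le _ _).trans (add_le_add ((abs_add_le _ _).trans (add_le_add ?_ c2)) c3)
      rwa [abs_neg]
    have t3 : |-(∑ i, q i * e i) - ∑ i, q i * d i + ∑ i, q i * e' i| ≤ Qa * E + Qa * R + Qa * E' := by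
      refine (abs_add_le _ _).trans (add_le_add ((abs_sub _ _).trans (add_le_add ?_ c5)) c6)
      rwa [abs_neg]
    linarith
  refine htri.trans (le_of_eq ?_)
  ring

/-- `re_dot_ge` with upper bounds on the three radii (the form used along a contour: `r` = real tangent oscillation, `ea, eb` = bounds
on the REAL parts of the tangent deviations). [folklore] -/
theorem re_dot_ge_of_le (a b : Fin 3 → ℂ) (t t' : Fin 3 → ℝ)
    (ha : ∑ i, a i ^ 2 = 1) (hb : ∑ i, b i ^ 2 = 1) (ht : ∑ i, t i ^ 2 = 1) (ht' : ∑ i, t' i ^ 2 = 1)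
    {r ea eb : ℝ} (hr : √(∑ i, (t i - t' i) ^ 2) ≤ r) (hea : √(∑ i, ((a i).re - t i) ^ 2) ≤ ea)
    (heb : √(∑ i, ((b i).re - t' i) ^ 2) ≤ eb) :
    1 - (r + ea + eb) ^ 2 / 2 ≤ (∑ i, a i * b i).re := by
  have h := re_dot_ge a b t t' ha hb ht ht'
  have h0 : 0 ≤ √(∑ i, (t i - t' i) ^ 2) + √(∑ i, ((a i).re - t i) ^ 2) + √(∑ i, ((b i).re - t' i) ^ 2) := by
    positivity
  have hle : √(∑ i, (t i - t' i) ^ 2) + √(∑ i, ((a i).re - t i) ^ 2) + √(∑ i, ((b i).re - t' i) ^ 2) ≤ r + ea + eb := by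
    linarith
  have hsq := pow_le_pow_left₀ h0 hle 2
  linarith

/-- `abs_im_dot_le` with upper bounds on the five radii. [folklore] -/
theorem abs_im_dot_le_of_le (a b : Fin 3 → ℂ) (t t' : Fin 3 → ℝ)
    (ha : ∑ i, a i ^ 2 = 1) (hb : ∑ i, b i ^ 2 = 1)
    {r ea eb qa qb : ℝ} (hr : √(∑ i, (t i - t' i) ^ 2) ≤ r) (hea : √(∑ i, ((a i).re - t i) ^ 2) ≤ ea)
    (heb : √(∑ i, ((b i).re - t' i) ^ 2) ≤ eb) (hqa : √(∑ i, (a i).im ^ 2) ≤ qa) (hqb : √(∑ i, (b i).im ^ 2) ≤ qb) :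
    |(∑ i, a i * b i).im| ≤ (qa + qb) * (r + ea + eb) := by
  have h := abs_im_dot_le a b t t' ha hb
  have h1 : 0 ≤ √(∑ i, (a i).im ^ 2) + √(∑ i, (b i).im ^ 2) := by positivity
  have h2 : 0 ≤ √(∑ i, (t i - t' i) ^ 2) + √(∑ i, ((a i).re - t i) ^ 2) + √(∑ i, ((b i).re - t' i) ^ 2) := by
    positivity
  refine h.trans (mul_le_mul (by linarith) (by linarith) h2 (h1.trans (by linarith)))

/-- **Principal-branch form.**  If the three real radii satisfy `r + ea + eb < √2` then `Re ∑ aᵢbᵢ > 0`: the pair product stays in the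
open right half-plane whatever the imaginary deviations are. [folklore] -/
theorem re_dot_pos_of_lt (a b : Fin 3 → ℂ) (t t' : Fin 3 → ℝ)
    (ha : ∑ i, a i ^ 2 = 1) (hb : ∑ i, b i ^ 2 = 1) (ht : ∑ i, t i ^ 2 = 1) (ht' : ∑ i, t' i ^ 2 = 1)
    {r ea eb : ℝ} (hr : √(∑ i, (t i - t' i) ^ 2) ≤ r) (hea : √(∑ i, ((a i).re - t i) ^ 2) ≤ ea)
    (heb : √(∑ i, ((b i).re - t' i) ^ 2) ≤ eb) (hsmall : (r + ea + eb) ^ 2 < 2) :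
    0 < (∑ i, a i * b i).re := by
  have h := re_dot_ge_of_le a b t t' ha hb ht ht' hr hea heb
  linarith

end Summit.NavierStokesRegularity.NavierStokesRegularity.Theorems.StadiumPairPositivity
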